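import Summits.HubbardSuperconductivity.HubbardSuperconductivity.Theorems.NodalWardXYNodalReductionKTBridgeHolds

/-!
# Crux `NodalWardXY.NodalReduction` (stmt-HubbardSuperconductivity-1268): what closes it, by pure logic

Line `Sketch`, lead seat -1 (2026-08-16). The crux is `VisonPairCost → PerturbedXYOrder → Window` with

  `Window := ∃ δ ∈ (0,1/2), ∃ U₀ > 0, ∀ U ∈ (0,U₀), ∃ μ, [GC tracial density of hubbardTorusWith 2 (L+1) 1 U μ → 1 − δ]
            ∧ HasDWaveOrder U μ`.

Since `VisonPairCost` is a theorem (stmt-HubbardSuperconductivity-1266, `Theorems.VisonPairCost.visonPairCost_proof`) and the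
Koma–Tasaki bridge `ktBridge : KTBridge` is a theorem (this line, p91948), the crux is closed by ANY of the following, recorded
here as arrows whose hypotheses are spelled out verbatim (no definitions, no named facts):

* `nodalReduction_of_window` — the window itself (both engine hypotheses are logically idle);
* `nodalReduction_of_orderFloor` — the window with `HasDWaveOrder U μ` replaced by any positive floor `0 < m ≤ dWaveOrderParameter U μ`;
* `nodalReduction_of_bcsConstruction` — the BODY of the sibling crux `WeakCouplingBCS.WcbcsBcsConstruction`
  (stmt-HubbardSuperconductivity-2010: floor `e^{−C/U²}`), word for word, so that a proof of stmt-2010 closes this crux by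
  `nodalReduction_of_bcsConstruction (by simpa using wcbcsBcsConstruction_proof)`-style application (the Theses file of the
  other route is deliberately NOT imported, per its header);
* `nodalReduction_of_plateauWindow` — the XY engine's own output currency: `PerturbedXYOrder →` a density-matched zero-field
  PLATEAU `a(L+1)⁴ ≤ Re ω₀(Δ_dᴴΔ_d)` eventually (stub (Z) of the skeleton with the proved vison hypothesis dropped), through
  `nodalReduction_of_zeroField ktBridge`.

Nothing here asserts the window; these are the bookkeeping edges the gate and the planners consume (crux 1268 hinges on
stmt-2010 or on a promoted plateau item).
-/

noncomputable section

-- `Summit.HubbardSuperconductivity.HubbardSuperconductivity.…` is the tree's summit/sub-problem namespace (D-0017).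
set_option linter.dupNamespace false

namespace Summit.HubbardSuperconductivity.HubbardSuperconductivity.Theorems.NodalReduction

open Filter
open Literature.MathematicalPhysics.QuantumLattice
open Summit.HubbardSuperconductivity.HubbardSuperconductivity.Theses.NodalWardXY
open scoped Matrix Topology

/-- **The window closes the crux.** `NodalReduction` is `VisonPairCost → PerturbedXYOrder → Window`; given the window,
both hypotheses are idle. -/
theorem nodalReduction_of_window : (∃ δ ∈ Set.Ioo (0:ℝ) (1/2), ∃ U₀ : ℝ, 0 < U₀ ∧ ∀ U ∈ Set.Ioo (0:ℝ) U₀, ∃ μ : ℝ, Filter.Tendsto (fun L : ℕ => ((Literature.MathematicalPhysics.QuantumLattice.hubbardTorusWith 2 (L + 1) 1 U μ).groundStateFunctional Literature.MathematicalPhysics.QuantumLattice.totalNumber).re / ((L + 1 : ℕ) : ℝ) ^ 2) Filter.atTop (nhds (1 - δ)) ∧ Literature.MathematicalPhysics.QuantumLattice.HasDWaveOrder U μ) → NodalReduction :=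
  fun h _ _ => h

/-- **Any positive order floor closes the crux.** The window with `HasDWaveOrder U μ` (`0 < dWaveOrderParameter U μ`)
replaced by a witnessed floor `0 < m ≤ dWaveOrderParameter U μ` (the shape every construction delivers). -/
theorem nodalReduction_of_orderFloor : (∃ δ ∈ Set.Ioo (0:ℝ) (1/2), ∃ U₀ : ℝ, 0 < U₀ ∧ ∀ U ∈ Set.Ioo (0:ℝ) U₀, ∃ μ : ℝ, Filter.Tendsto (fun L : ℕ => ((Literature.MathematicalPhysics.QuantumLattice.hubbardTorusWith 2 (L + 1) 1 U μ).groundStateFunctional Literature.MathematicalPhysics.QuantumLattice.totalNumber).re / ((L + 1 : ℕ) : ℝ) ^ 2) Filter.atTop (nhds (1 - δ)) ∧ ∃ m : ℝ, 0 < m ∧ m ≤ Literature.MathematicalPhysics.QuantumLattice.dWaveOrderParameter U μ) → NodalReduction := by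
  rintro ⟨δ, hδ, U₀, hU₀, hwin⟩
  refine nodalReduction_of_window ⟨δ, hδ, U₀, hU₀, fun U hU => ?_⟩
  obtain ⟨μ, hdens, m, hm, hle⟩ := hwin U hU
  exact ⟨μ, hdens, lt_of_lt_of_le hm hle⟩

/-- **The sibling crux closes this one.** The hypothesis is, word for word, the body of
`WeakCouplingBCS.WcbcsBcsConstruction` (stmt-HubbardSuperconductivity-2010): a doping `δ ∈ (0,1/2)`, a weak-coupling window
`U ∈ (0,U₀)` with a density-matched `μ` and the BCS floor `e^{−C/U²} ≤ dWaveOrderParameter U μ`. Since `0 < e^{−C/U²}`, this is an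
order floor, hence the window, hence `NodalReduction`. -/
theorem nodalReduction_of_bcsConstruction : (∃ δ ∈ Set.Ioo (0:ℝ) (1 / 2), ∃ U₀ : ℝ, 0 < U₀ ∧ ∃ C : ℝ, 0 < C ∧ ∀ U ∈ Set.Ioo (0:ℝ) U₀, ∃ μ : ℝ, Filter.Tendsto (fun L : ℕ => ((Literature.MathematicalPhysics.QuantumLattice.hubbardTorusWith 2 (L + 1) 1 U μ).groundStateFunctional Literature.MathematicalPhysics.QuantumLattice.totalNumber).re / ((L + 1 : ℕ) : ℝ) ^ 2) Filter.atTop (nhds (1 - δ)) ∧ Real.exp (-C / U ^ 2) ≤ Literature.MathematicalPhysics.QuantumLattice.dWaveOrderParameter U μ) → NodalReduction := by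
  rintro ⟨δ, hδ, U₀, hU₀, C, -, hwin⟩
  refine nodalReduction_of_orderFloor ⟨δ, by simpa using hδ, U₀, hU₀, fun U hU => ?_⟩
  obtain ⟨μ, hdens, hle⟩ := hwin U hU
  exact ⟨μ, hdens, Real.exp (-C / U ^ 2), Real.exp_pos _, hle⟩

/-- **The XY engine's output currency closes the crux.** Stub (Z) `ZeroFieldTarget` of line `Sketch` with its first
hypothesis dropped (`VisonPairCost` is proved): from `PerturbedXYOrder`, a density-matched zero-field PLATEAU
`a(L+1)⁴ ≤ Re ω₀(Δ_dᴴΔ_d)` eventually in `L`; the Koma–Tasaki bridge `ktBridge` (`√(a/2) ≤ dWaveOrderParameter`) and the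
composition `nodalReduction_of_zeroField` do the rest. -/
theorem nodalReduction_of_plateauWindow : (PerturbedXYOrder → ∃ δ ∈ Set.Ioo (0:ℝ) (1/2), ∃ U₀ : ℝ, 0 < U₀ ∧ ∀ U ∈ Set.Ioo (0:ℝ) U₀, ∃ μ : ℝ, Filter.Tendsto (fun L : ℕ => ((Literature.MathematicalPhysics.QuantumLattice.hubbardTorusWith 2 (L + 1) 1 U μ).groundStateFunctional Literature.MathematicalPhysics.QuantumLattice.totalNumber).re / ((L + 1 : ℕ) : ℝ) ^ 2) Filter.atTop (nhds (1 - δ)) ∧ ∃ a : ℝ, 0 < a ∧ ∀ᶠ L : ℕ in Filter.atTop, a * (((L + 1 : ℕ) : ℝ)) ^ 4 ≤ ((Literature.MathematicalPhysics.QuantumLattice.hubbardTorusWith 2 (L + 1) 1 U μ).groundStateFunctional ((Literature.MathematicalPhysics.QuantumLattice.pairField Literature.MathematicalPhysics.QuantumLattice.dWaveFormFactor (L + 1))ᴴ * Literature.MathematicalPhysics.QuantumLattice.pairField Literature.MathematicalPhysics.QuantumLattice.dWaveFormFactor (L + 1))).re) → NodalReduction :=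
  fun h => nodalReduction_of_zeroField ktBridge (fun _ hP => h hP)

end Summit.HubbardSuperconductivity.HubbardSuperconductivity.Theorems.NodalReduction

end
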